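import Summits.KontsevichZagierPeriods.KontsevichZagierPeriods.Theorems.OctahedralSymmetryOctahedralSpanAllWeightsRealForm
import Summits.KontsevichZagierPeriods.KontsevichZagierPeriods.Theorems.OctahedralSymmetryOctahedralSpanAllWeightsConjStable
import Summits.KontsevichZagierPeriods.KontsevichZagierPeriods.Theorems.OctahedralSymmetryOctahedralSpanAllWeightsStubWeightTwo
import Mathlib.LinearAlgebra.Dimension.Constructions
import Mathlib.LinearAlgebra.LinearIndependent.Lemmas
import Mathlib.LinearAlgebra.Quotient.Basic

/-!
# Crux `OctahedralSpanAllWeights` (stmt-KontsevichZagierPeriods-9659), line `Sketch`: real form ⟺ complex form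

The REAL form `RealSpanBound w` of the informal crux (symbols `Re I(W)`, `Im I(W)`; real/imaginary parts of
the rational-coefficient complex families plus conjugation; file `…RealForm`) and the typed COMPLEX form
`SpanBound w` (Defs file) are EQUIVALENT with the same bound `2^w` (`realSpanBound_iff_spanBound`).
`…RealForm` proved complex ⟹ real. Here: the `ℚ`-linear map `Θ : Re W ↦ ([W]+[W̄])/2, Im W ↦ ([W̄]−[W])/2`
satisfies `Θ(Re W) − Θ(Im W) = [W]`, kills the conjugation relations and maps the real parts of relations
into `rel` (`Θ ∘ Re = (1+c)/2`, `Θ ∘ Im = (c−1)/2` with `c` = conjugation, and `rel` is `c`-stable, file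
`…ConjStable`); so a real spanning set of `≤ 2^w` symbols gives `≤ 2^w` vectors spanning the images of the
convergent words of weight `w` in `WordQ ⧸ rel`, and a basis of that finite-dimensional span can be chosen
among the word images themselves (`exists_linearIndependent`) and lifted to words. No `ℚ(i)` is needed.
Sources: J. Zhao, Doc. Math. 15 (2010) §1–§2 [Zhao2010]; the route's item text (six real families).
-/

noncomputable section

namespace Summit.KontsevichZagierPeriods.OctahedralSymmetry.OctaSpan

open Literature.NumberTheory.Transcendental Literature.NumberTheory.Transcendental.LevelFour

/-! ## Θ : the real module → the word module -/

/-- `Θ(Re W) = ([W] + [W̄])/2`, `Θ(Im W) = ([W̄] − [W])/2`, linearly. [folklore] -/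
def theta : RWordQ →ₗ[ℚ] WordQ :=
  Finsupp.linearCombination ℚ fun p : Bool × List (Fin 5) =>
    if p.1 then (2 : ℚ)⁻¹ • (sym p.2 + sym (conjWord p.2)) else (2 : ℚ)⁻¹ • (sym (conjWord p.2) - sym p.2)

/-- [folklore] -/
@[simp] theorem theta_single (p : Bool × List (Fin 5)) (c : ℚ) :
    theta (Finsupp.single p c) = c • (if p.1 then (2 : ℚ)⁻¹ • (sym p.2 + sym (conjWord p.2))
      else (2 : ℚ)⁻¹ • (sym (conjWord p.2) - sym p.2)) := by
  simp [theta, Finsupp.linearCombination_single]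

/-- [folklore] -/
theorem theta_reSym (W : List (Fin 5)) : theta (reSym W) = (2 : ℚ)⁻¹ • (sym W + sym (conjWord W)) := by
  simp [reSym]

/-- [folklore] -/
theorem theta_imSym (W : List (Fin 5)) : theta (imSym W) = (2 : ℚ)⁻¹ • (sym (conjWord W) - sym W) := by
  simp [imSym]

/-- `Θ(Re W) − Θ(Im W) = [W]`. [folklore] -/
theorem theta_re_sub_im (W : List (Fin 5)) : theta (reSym W) - theta (imSym W) = sym W := by
  rw [theta_reSym, theta_imSym, ← smul_sub]
  have : sym W + sym (conjWord W) - (sym (conjWord W) - sym W) = (2 : ℚ) • sym W := by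
    rw [two_smul]; abel
  rw [this, smul_smul]; norm_num

/-- `Θ ∘ Re = (id + conj)/2`. [folklore] -/
theorem theta_reLin (ρ : WordQ) : theta (reLin ρ) = (2 : ℚ)⁻¹ • (ρ + conjQ ρ) := by
  have h : theta ∘ₗ reLin = (2 : ℚ)⁻¹ • (LinearMap.id + conjQ) := by
    refine Finsupp.lhom_ext' fun V => LinearMap.ext_ring ?_
    simp only [LinearMap.coe_comp, Function.comp_apply, Finsupp.lsingle_apply, LinearMap.smul_apply,
      LinearMap.add_apply, LinearMap.id_apply]
    rw [show Finsupp.single V (1 : ℚ) = sym V from rfl, reLin_sym, theta_reSym, conjQ_sym]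
  exact LinearMap.congr_fun h ρ

/-- `Θ ∘ Im = (conj − id)/2`. [folklore] -/
theorem theta_imLin (ρ : WordQ) : theta (imLin ρ) = (2 : ℚ)⁻¹ • (conjQ ρ - ρ) := by
  have h : theta ∘ₗ imLin = (2 : ℚ)⁻¹ • (conjQ - LinearMap.id) := by
    refine Finsupp.lhom_ext' fun V => LinearMap.ext_ring ?_
    simp only [LinearMap.coe_comp, Function.comp_apply, Finsupp.lsingle_apply, LinearMap.smul_apply,
      LinearMap.sub_apply, LinearMap.id_apply]
    rw [show Finsupp.single V (1 : ℚ) = sym V from rfl, imLin_sym, theta_imSym, conjQ_sym]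
  exact LinearMap.congr_fun h ρ

/-- `Θ` kills the conjugation relations. [folklore] -/
theorem theta_conjRel_eq_zero {x : RWordQ} (hx : x ∈ conjRel) : theta x = 0 := by
  induction hx using Submodule.span_induction with
  | mem x hx =>
    obtain ⟨W, rfl | rfl⟩ := hx
    · rw [map_sub, theta_reSym, theta_reSym, conjWord_conjWord, ← smul_sub]
      have : sym (conjWord W) + sym W - (sym W + sym (conjWord W)) = 0 := by abel
      rw [this, smul_zero]
    · rw [map_add, theta_imSym, theta_imSym, conjWord_conjWord, ← smul_add]
      have : sym W - sym (conjWord W) + (sym (conjWord W) - sym W) = 0 := by abel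
      rw [this, smul_zero]
  | zero => simp
  | add x y _ _ hx hy => rw [map_add, hx, hy, add_zero]
  | smul a x _ hx => rw [map_smul, hx, smul_zero]

/-- **`Θ(realRel) ⊆ rel`** (by the conjugation-stability of `rel`, `conjQ_mem_rel`). [folklore] -/
theorem theta_realRel_le {x : RWordQ} (hx : x ∈ realRel) :
    theta x ∈ rel := by
  rw [realRel, Submodule.mem_sup] at hx
  obtain ⟨y, hy, c, hc, rfl⟩ := hx
  rw [Submodule.mem_sup] at hy
  obtain ⟨a, ha, b, hb, rfl⟩ := hy
  obtain ⟨ρ, hρ, rfl⟩ := ha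
  obtain ⟨ρ', hρ', rfl⟩ := hb
  rw [map_add, map_add, theta_reLin, theta_imLin, theta_conjRel_eq_zero hc, add_zero]
  exact rel.add_mem (rel.smul_mem _ (rel.add_mem hρ (conjQ_mem_rel hρ)))
    (rel.smul_mem _ (rel.sub_mem (conjQ_mem_rel hρ') hρ'))

/-! ## The real span bound implies the complex one (basis extraction in the quotient) -/

/-- Pull-back of a span through the quotient map: if `π x ∈ span (π '' Z)` then `x ∈ ker ⊔ span Z`.
[folklore] -/
theorem mem_sup_span_of_mkQ_mem {N : Submodule ℚ WordQ} {Z : Set WordQ} {x : WordQ}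
    (h : N.mkQ x ∈ Submodule.span ℚ (N.mkQ '' Z)) : x ∈ N ⊔ Submodule.span ℚ Z := by
  rw [← Submodule.map_span] at h
  obtain ⟨z, hz, hzx⟩ := h
  have : x - z ∈ N := by
    rw [← Submodule.Quotient.mk_eq_zero, ← Submodule.mkQ_apply, map_sub, sub_eq_zero]
    exact hzx.symm
  have hx : x = (x - z) + z := by abel
  rw [hx]
  exact Submodule.add_mem _ (Submodule.mem_sup_left this) (Submodule.mem_sup_right hz)

/-- **The real span bound implies the complex span bound** (same `2^w`), given the conjugation
stability of `rel` (`…ConjStable`): apply `Θ` to get `[W] ∈ rel ⊔ span Θ(S')` for every convergent `W` of weight `w`,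
so the images of these words span a subspace of dimension `≤ #S' ≤ 2^w` of `WordQ ⧸ rel`; extract a basis
consisting of word images and lift. [folklore] -/
theorem spanBound_of_realSpanBound {w : ℕ} (h : RealSpanBound w) : SpanBound w := by
  classical
  obtain ⟨S', hcard, hS'⟩ := h
  set π := rel.mkQ with hπ
  set Y : Finset (WordQ ⧸ rel) := S'.image fun p => π (theta (Finsupp.single p (1 : ℚ))) with hY
  -- (1) every convergent word of weight `w` maps into `span Y`
  have hmem : ∀ W : List (Fin 5), W.length = w → IsConvergent W →
      π (sym W) ∈ Submodule.span ℚ (↑Y : Set (WordQ ⧸ rel)) := by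
    intro W hlen hW
    obtain ⟨hre, him⟩ := hS' W hlen hW
    have key : ∀ x : RWordQ, x ∈ realRel ⊔ Submodule.span ℚ ((fun p => Finsupp.single p (1 : ℚ)) '' ↑S') →
        π (theta x) ∈ Submodule.span ℚ (↑Y : Set (WordQ ⧸ rel)) := by
      intro x hx
      obtain ⟨r, hr, l, hl, rfl⟩ := Submodule.mem_sup.1 hx
      rw [map_add, map_add]
      have h0 : π (theta r) = 0 := (Submodule.Quotient.mk_eq_zero _).2 (theta_realRel_le hr)
      rw [h0, zero_add]
      refine Submodule.span_induction (p := fun y _ => π (theta y) ∈ Submodule.span ℚ (↑Y : Set _)) ?_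
        (by simp) (fun a b _ _ ha hb => by rw [map_add, map_add]; exact Submodule.add_mem _ ha hb)
        (fun c a _ ha => by rw [map_smul, map_smul]; exact Submodule.smul_mem _ c ha) hl
      rintro _ ⟨p, hp, rfl⟩
      exact Submodule.subset_span (Finset.mem_coe.2 (Finset.mem_image.2 ⟨p, hp, rfl⟩))
    have := Submodule.sub_mem _ (key _ hre) (key _ him)
    rwa [← map_sub, theta_re_sub_im] at this
  -- (2) the word images and their span
  set A : Set (WordQ ⧸ rel) := (fun W => π (sym W)) '' {W | W.length = w ∧ IsConvergent W} with hA
  have hAfin : A.Finite := by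
    refine Set.Finite.image _ ?_
    refine Set.Finite.subset (List.finite_toSet (allWords w)) fun W hW => ?_
    exact hW.1 ▸ mem_allWords W
  have hAle : Submodule.span ℚ A ≤ Submodule.span ℚ (↑Y : Set (WordQ ⧸ rel)) :=
    Submodule.span_le.2 (by rintro _ ⟨W, ⟨hlen, hW⟩, rfl⟩; exact hmem W hlen hW)
  -- (3) extract a basis of `span A` inside `A`
  obtain ⟨B, hBA, hspan, hli⟩ := exists_linearIndependent ℚ A
  have hBfin : B.Finite := hAfin.subset hBA
  haveI : Fintype B := hBfin.fintype
  have hcardB : hBfin.toFinset.card ≤ 2 ^ w := by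
    have h1 : Module.finrank ℚ (Submodule.span ℚ B) = B.toFinset.card :=
      finrank_span_set_eq_card (s := B) hli
    have h2 : Module.finrank ℚ (Submodule.span ℚ B) ≤ Module.finrank ℚ (Submodule.span ℚ (↑Y : Set _)) :=
      Submodule.finrank_mono (hspan ▸ hAle)
    have h3 : Module.finrank ℚ (Submodule.span ℚ (↑Y : Set (WordQ ⧸ rel))) ≤ Y.card :=
      finrank_span_finset_le_card Y
    have h4 : Y.card ≤ S'.card := Finset.card_image_le
    have : B.toFinset = hBfin.toFinset := by ext; simp
    rw [← this]; omega
  -- (4) choose one word per basis vector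
  have hsec : ∀ b ∈ hBfin.toFinset, ∃ W : List (Fin 5), (W.length = w ∧ IsConvergent W) ∧ π (sym W) = b := by
    intro b hb
    obtain ⟨W, hW, rfl⟩ := hBA (hBfin.mem_toFinset.1 hb)
    exact ⟨W, hW, rfl⟩
  choose! sec hsec1 hsec2 using hsec
  refine ⟨hBfin.toFinset.image sec, (Finset.card_image_le).trans hcardB, fun W hlen hW => ?_⟩
  -- (5) spanning
  have hWA : π (sym W) ∈ Submodule.span ℚ A := Submodule.subset_span ⟨W, ⟨hlen, hW⟩, rfl⟩
  rw [← hspan] at hWA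
  have hBimg : B ⊆ π '' (sym '' ↑(hBfin.toFinset.image sec)) := by
    intro b hb
    have hb' : b ∈ hBfin.toFinset := hBfin.mem_toFinset.2 hb
    refine ⟨sym (sec b), ⟨sec b, ?_, rfl⟩, hsec2 b hb'⟩
    exact Finset.mem_coe.2 (Finset.mem_image.2 ⟨b, hb', rfl⟩)
  exact mem_sup_span_of_mkQ_mem (Submodule.span_mono hBimg hWA)

end Summit.KontsevichZagierPeriods.OctahedralSymmetry.OctaSpan

end
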